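import Summits.Ventures.PercRepro.S2MaxExtension
import Mathlib.Combinatorics.Enumerative.DoubleCounting

/-!
# PercRepro — S2: THE MAXIMAL SPANNING EXTENSIONS OF A CIRCUIT, DOUBLE COUNTED (p7, gen 13; sub-claim S2; the cells `(14, 8 … 11)`)

`(Matroid.subsF (Matroid.groundF M) j).filter (fun B' => Disjoint B' C ∧ M.eRk (C ∪ B') = 5 ∧ (M.closure (C ∪ B')).ncard = f)` = the `j`-subsets `B′ ⊆ E ∖ C` with `ρ(C ∪ B′) = 5` and `|cl(C ∪ B′)| = f` — the spanning `6`-sets through a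
circuit `C` of `6 − j` points whose closure is MAXIMAL. With `e` a bound on `#maxExt P f` over the rank-`4` flats `P` with `≥ 5`
points (S2MaxExtension's `card_maxExt_le` at every `|P|`): **`card_extMax_one_le`** — `#extMax C 1 f ≤ #maxExt (cl C) f` for a
rank-`4` set `C` (the `5`-circuits); **`card_extMax_two_mul_le`** — `2·#extMax C 2 f ≤ |E ∖ C|·e` for a rank-`3` set of `≥ 4` points
(the `4`-circuits: every pair `{x, y}` has both points in `E ∖ C`, and through a point `x ∉ cl C` the pairs are the maximal
extensions of the rank-`4` flat `cl(C ∪ x)`); **`card_extMax_three_mul_le`** — `6·#extMax C 3 f ≤ (|E ∖ C|² − |E ∖ C|)·e` for a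
triangle (the ordered pairs `(x, y)` of distinct points off `C`; through a pair with `ρ(C ∪ {x, y}) = 4` the triples are the maximal
extensions of `cl(C ∪ {x, y})`). Both by `Finset.card_mul_le_card_mul`. Axioms: standard.
-/

open scoped Matroid

namespace PercRepro

namespace S2

open Set Finset

variable {α : Type} {M : Matroid α}

/-- Membership in `subsF`. -/
theorem mem_subsF_iff {S : Finset α} {j : ℕ} {B' : Set α} :
    B' ∈ Matroid.subsF S j ↔ B' ⊆ (S : Set α) ∧ B'.ncard = j := by
  constructor
  · intro h
    unfold Matroid.subsF at h
    obtain ⟨s, hs, rfl⟩ := Finset.mem_image.1 h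
    rw [Finset.mem_powersetCard] at hs
    exact ⟨Finset.coe_subset.2 hs.1, by rw [Set.ncard_coe_finset]; exact hs.2⟩
  · rintro ⟨h1, h2⟩
    exact Matroid.mem_subsF_of h1 h2

open scoped Classical in
/-- Membership in `extMax`. -/
theorem mem_extMax [M.Finite] {C : Set α} {j f : ℕ} {B' : Set α} :
    B' ∈ (Matroid.subsF (Matroid.groundF M) j).filter (fun B' => Disjoint B' C ∧ M.eRk (C ∪ B') = 5 ∧ (M.closure (C ∪ B')).ncard = f) ↔ (B' ⊆ M.E ∧ B'.ncard = j) ∧ Disjoint B' C ∧ M.eRk (C ∪ B') = 5 ∧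
      (M.closure (C ∪ B')).ncard = f := by
  rw [Finset.mem_filter, mem_subsF_iff, Matroid.coe_groundF]

open scoped Classical in
/-- **`5`-circuits**: the maximal spanning extensions of a rank-`4` set `C` are maximal extensions of its closure. -/
theorem card_extMax_one_le [M.Finite] {C : Set α} (hCr : M.eRk C = 4) (f : ℕ) :
    ((Matroid.subsF (Matroid.groundF M) 1).filter (fun B' => Disjoint B' C ∧ M.eRk (C ∪ B') = 5 ∧ (M.closure (C ∪ B')).ncard = f)).card ≤ ({x ∈ M.E \ M.closure C | (M.closure (insert x (M.closure C))).ncard = f}).ncard := by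
  classical
  have hfin : ({x ∈ M.E \ M.closure C | (M.closure (insert x (M.closure C))).ncard = f}).Finite := M.ground_finite.subset (maxExt_subset_ground _ f)
  rw [Set.ncard_eq_toFinset_card _ hfin]
  refine (Finset.card_le_card (?_ : (Matroid.subsF (Matroid.groundF M) 1).filter (fun B' => Disjoint B' C ∧ M.eRk (C ∪ B') = 5 ∧ (M.closure (C ∪ B')).ncard = f) ⊆ hfin.toFinset.image (fun x => ({x} : Set α)))).trans
    Finset.card_image_le
  intro B' hB'
  obtain ⟨⟨hB'E, hB'1⟩, hdis, hr, hcl⟩ := mem_extMax.1 hB'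
  obtain ⟨x, rfl⟩ := Set.ncard_eq_one.1 hB'1
  rw [Finset.mem_image]
  refine ⟨x, ?_, rfl⟩
  rw [Set.Finite.mem_toFinset, mem_maxExt]
  have hxE : x ∈ M.E := hB'E (Set.mem_singleton x)
  have hxC : x ∉ M.closure C := by
    intro hx
    have h := M.closure_insert_eq_of_mem_closure hx
    rw [Set.union_singleton, ← M.eRk_closure_eq, h, M.eRk_closure_eq, hCr] at hr
    norm_num at hr
  refine ⟨hxE, hxC, ?_⟩
  rw [M.closure_insert_closure_eq_closure_insert, ← Set.union_singleton]
  exact hcl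

/-- A `2`-set containing `x` is `{x, y}` with `y ≠ x`. -/
theorem exists_eq_pair_of_ncard_eq_two {B' : Set α} (h : B'.ncard = 2) {x : α} (hx : x ∈ B') :
    ∃ y, y ≠ x ∧ B' = {x, y} := by
  obtain ⟨a, b, hab, rfl⟩ := Set.ncard_eq_two.1 h
  rcases hx with rfl | rfl
  · exact ⟨b, hab.symm, rfl⟩
  · exact ⟨a, hab, Set.pair_comm _ _⟩

/-- A `3`-set containing two distinct points `x ≠ y` is `{x, y} ∪ {z}` with `z ∉ {x, y}`. -/
theorem exists_eq_of_ncard_eq_three {B' : Set α} (h : B'.ncard = 3) {x y : α} (hx : x ∈ B') (hy : y ∈ B')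
    (hxy : x ≠ y) : ∃ z, z ≠ x ∧ z ≠ y ∧ B' = {x, y} ∪ {z} := by
  have hfin : B'.Finite := Set.finite_of_ncard_pos (by omega)
  have hsub : ({x, y} : Set α) ⊆ B' := Set.insert_subset hx (Set.singleton_subset_iff.2 hy)
  have h1 : (B' \ {x, y}).ncard = 1 := by
    rw [Set.ncard_sdiff hsub (Set.toFinite _), h, Set.ncard_pair hxy]
  obtain ⟨z, hz⟩ := Set.ncard_eq_one.1 h1
  have hzmem : z ∈ B' \ {x, y} := by rw [hz]; exact Set.mem_singleton z
  refine ⟨z, ?_, ?_, ?_⟩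
  · intro hzx; exact hzmem.2 (by rw [hzx]; exact Set.mem_insert x {y})
  · intro hzy; exact hzmem.2 (by rw [hzy]; exact Set.mem_insert_of_mem x rfl)
  · rw [← hz, Set.union_sdiff_cancel hsub]

/-- `cl(P ∪ y)` for `y` in the closure of `P ∪ x`, in rank terms: if `y ∈ cl(Q)` then `ρ(insert y Q) = ρ(Q)`. -/
theorem eRk_insert_eq_of_mem_closure {Q : Set α} {y : α} (hy : y ∈ M.closure Q) :
    M.eRk (insert y Q) = M.eRk Q := by
  rw [← M.eRk_closure_eq, M.closure_insert_eq_of_mem_closure hy, M.eRk_closure_eq]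

open scoped Classical in
/-- **`4`-circuits, double counted**: for a rank-`3` set `C ⊆ E` with `≥ 4` points, `2·#extMax C 2 f ≤ |E ∖ C|·e` whenever
`e` bounds the maximal extensions of every rank-`4` flat with `≥ 5` points. -/
theorem card_extMax_two_mul_le [M.Finite] {C : Set α} (hCE : C ⊆ M.E) (hCr : M.eRk C = 3) (hC4 : 4 ≤ C.ncard)
    (f e : ℕ) (he : ∀ P ⊆ M.E, M.closure P = P → M.eRk P = 4 → 5 ≤ P.ncard → ({x ∈ M.E \ P | (M.closure (insert x P)).ncard = f}).ncard ≤ e) :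
    ((Matroid.subsF (Matroid.groundF M) 2).filter (fun B' => Disjoint B' C ∧ M.eRk (C ∪ B') = 5 ∧ (M.closure (C ∪ B')).ncard = f)).card * 2 ≤ (M.E \ C).ncard * e := by
  classical
  have hECfin : (M.E \ C).Finite := M.ground_finite.subset Set.sdiff_subset
  set t : Finset α := hECfin.toFinset with htdef
  have hmemt : ∀ x, x ∈ t ↔ x ∈ M.E ∧ x ∉ C := fun x => by
    rw [htdef, Set.Finite.mem_toFinset, Set.mem_sdiff]
  rw [Set.ncard_eq_toFinset_card _ hECfin]
  refine Finset.card_mul_le_card_mul (fun (B' : Set α) (x : α) => x ∈ B') ?_ ?_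
  · intro B' hB'
    obtain ⟨⟨hB'E, hB'2⟩, hdis, -, -⟩ := mem_extMax.1 hB'
    obtain ⟨a, b, hab, rfl⟩ := Set.ncard_eq_two.1 hB'2
    have ha : a ∈ t := (hmemt a).2 ⟨hB'E (Set.mem_insert a {b}), Set.disjoint_left.1 hdis (Set.mem_insert a {b})⟩
    have hb : b ∈ t := (hmemt b).2 ⟨hB'E (Set.mem_insert_of_mem a rfl), Set.disjoint_left.1 hdis (Set.mem_insert_of_mem a rfl)⟩
    calc 2 = ({a, b} : Finset α).card := (Finset.card_pair hab).symm
      _ ≤ _ := Finset.card_le_card (by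
          intro z hz
          rw [Finset.mem_bipartiteAbove]
          rcases Finset.mem_insert.1 hz with rfl | hz
          · exact ⟨ha, Set.mem_insert z {b}⟩
          · rw [Finset.mem_singleton] at hz
            subst hz
            exact ⟨hb, Set.mem_insert_of_mem a rfl⟩)
  · intro x hx
    obtain ⟨hxE, hxC⟩ := (hmemt x).1 hx
    by_cases hxcl : x ∈ M.closure C
    · -- no maximal spanning pair through a point of `cl C`
      have : ((Matroid.subsF (Matroid.groundF M) 2).filter (fun B' => Disjoint B' C ∧ M.eRk (C ∪ B') = 5 ∧ (M.closure (C ∪ B')).ncard = f)).bipartiteBelow (fun (B' : Set α) (x : α) => x ∈ B') x = ∅ := by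
        rw [Finset.eq_empty_iff_forall_notMem]
        intro B' hB'
        rw [Finset.mem_bipartiteBelow] at hB'
        obtain ⟨hB'mem, hxB'⟩ := hB'
        obtain ⟨⟨hB'E, hB'2⟩, hdis, hr, -⟩ := mem_extMax.1 hB'mem
        obtain ⟨y, hyx, rfl⟩ := exists_eq_pair_of_ncard_eq_two hB'2 hxB'
        have hunion : C ∪ ({x, y} : Set α) = insert x (insert y C) := by
          ext z; simp only [Set.mem_union, Set.mem_insert_iff, Set.mem_singleton_iff]; tauto
        have hxcl' : x ∈ M.closure (insert y C) := M.closure_subset_closure (Set.subset_insert y C) hxcl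
        rw [hunion, eRk_insert_eq_of_mem_closure hxcl'] at hr
        have h1 : M.eRk (insert y C) ≤ M.eRk C + 1 := M.eRk_insert_le_add_one _ _
        rw [hr, hCr] at h1
        norm_num at h1
      rw [this, Finset.card_empty]
      exact Nat.zero_le e
    · -- the pairs `{x, y}` through `x ∉ cl C` are the maximal extensions of the rank-`4` flat `cl(C ∪ x)`
      set P : Set α := M.closure (insert x C) with hPdef
      have hPE : P ⊆ M.E := M.closure_subset_ground _
      have hPflat : M.closure P = P := M.closure_closure _
      have hPr : M.eRk P = 4 := by
        rw [hPdef, M.eRk_closure_eq, M.eRk_insert_eq_add_one ⟨hxE, hxcl⟩, hCr]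
        norm_num
      have hP5 : 5 ≤ P.ncard := by
        have h1 : (insert x C).ncard = C.ncard + 1 :=
          Set.ncard_insert_of_notMem hxC (M.ground_finite.subset hCE)
        have h2 : (insert x C).ncard ≤ P.ncard :=
          Set.ncard_le_ncard (M.subset_closure _ (Set.insert_subset hxE hCE)) (M.ground_finite.subset hPE)
        omega
      have hfin : ({x ∈ M.E \ P | (M.closure (insert x P)).ncard = f}).Finite := M.ground_finite.subset (maxExt_subset_ground _ f)
      refine le_trans ?_ (he P hPE hPflat hPr hP5)
      rw [Set.ncard_eq_toFinset_card _ hfin]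
      refine (Finset.card_le_card (?_ : _ ⊆ hfin.toFinset.image (fun y => ({x, y} : Set α)))).trans
        Finset.card_image_le
      intro B' hB'
      rw [Finset.mem_bipartiteBelow] at hB'
      obtain ⟨hB'mem, hxB'⟩ := hB'
      obtain ⟨⟨hB'E, hB'2⟩, hdis, hr, hcl⟩ := mem_extMax.1 hB'mem
      obtain ⟨y, hyx, rfl⟩ := exists_eq_pair_of_ncard_eq_two hB'2 hxB'
      rw [Finset.mem_image]
      refine ⟨y, ?_, rfl⟩
      rw [Set.Finite.mem_toFinset, mem_maxExt]
      have hyE : y ∈ M.E := hB'E (Set.mem_insert_of_mem x rfl)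
      have hunion : C ∪ ({x, y} : Set α) = insert y (insert x C) := by
        ext z; simp only [Set.mem_union, Set.mem_insert_iff, Set.mem_singleton_iff]; tauto
      have hyP : y ∉ P := by
        intro hyP
        rw [hunion, eRk_insert_eq_of_mem_closure hyP, M.eRk_insert_eq_add_one ⟨hxE, hxcl⟩, hCr] at hr
        norm_num at hr
      refine ⟨hyE, hyP, ?_⟩
      rw [hPdef, M.closure_insert_closure_eq_closure_insert, ← hunion]
      exact hcl

open scoped Classical in
/-- **Triangles, double counted**: for a rank-`2` set `C ⊆ E` of `3` points, `6·#extMax C 3 f ≤ (|E ∖ C|² − |E ∖ C|)·e`. -/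
theorem card_extMax_three_mul_le [M.Finite] {C : Set α} (hCE : C ⊆ M.E) (hCr : M.eRk C = 2) (hC3 : C.ncard = 3)
    (f e : ℕ) (he : ∀ P ⊆ M.E, M.closure P = P → M.eRk P = 4 → 5 ≤ P.ncard → ({x ∈ M.E \ P | (M.closure (insert x P)).ncard = f}).ncard ≤ e) :
    ((Matroid.subsF (Matroid.groundF M) 3).filter (fun B' => Disjoint B' C ∧ M.eRk (C ∪ B') = 5 ∧ (M.closure (C ∪ B')).ncard = f)).card * 6 ≤ ((M.E \ C).ncard * (M.E \ C).ncard - (M.E \ C).ncard) * e := by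
  classical
  have hECfin : (M.E \ C).Finite := M.ground_finite.subset Set.sdiff_subset
  set t : Finset α := hECfin.toFinset with htdef
  have hmemt : ∀ x, x ∈ t ↔ x ∈ M.E ∧ x ∉ C := fun x => by
    rw [htdef, Set.Finite.mem_toFinset, Set.mem_sdiff]
  rw [Set.ncard_eq_toFinset_card _ hECfin, ← Finset.offDiag_card]
  refine Finset.card_mul_le_card_mul (fun (B' : Set α) (xy : α × α) => xy.1 ∈ B' ∧ xy.2 ∈ B') ?_ ?_
  · intro B' hB'
    obtain ⟨⟨hB'E, hB'3⟩, hdis, -, -⟩ := mem_extMax.1 hB'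
    have hB'fin : B'.Finite := M.ground_finite.subset hB'E
    have hsub : hB'fin.toFinset ⊆ t := by
      intro z hz
      rw [Set.Finite.mem_toFinset] at hz
      exact (hmemt z).2 ⟨hB'E hz, Set.disjoint_left.1 hdis hz⟩
    have hcard : hB'fin.toFinset.card = 3 := by rw [← Set.ncard_eq_toFinset_card _ hB'fin]; exact hB'3
    calc 6 = hB'fin.toFinset.offDiag.card := by rw [Finset.offDiag_card, hcard]
      _ ≤ _ := Finset.card_le_card (by
          intro xy hxy
          rw [Finset.mem_offDiag] at hxy
          obtain ⟨h1, h2, h3⟩ := hxy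
          rw [Set.Finite.mem_toFinset] at h1 h2
          rw [Finset.mem_bipartiteAbove, Finset.mem_offDiag]
          exact ⟨⟨hsub ((Set.Finite.mem_toFinset hB'fin).2 h1), hsub ((Set.Finite.mem_toFinset hB'fin).2 h2), h3⟩, h1, h2⟩)
  · rintro ⟨x, y⟩ hxy
    rw [Finset.mem_offDiag] at hxy
    obtain ⟨hx, hy, hxy⟩ := hxy
    obtain ⟨hxE, hxC⟩ := (hmemt x).1 hx
    obtain ⟨hyE, hyC⟩ := (hmemt y).1 hy
    simp only at hxy
    set Q : Set α := insert y (insert x C) with hQdef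
    have hQE : Q ⊆ M.E := Set.insert_subset hyE (Set.insert_subset hxE hCE)
    -- every member of the fibre is `{x, y} ∪ {z}` with `C ∪ B′ = insert z Q`
    have hfibre : ∀ B' ∈ ((Matroid.subsF (Matroid.groundF M) 3).filter (fun B' => Disjoint B' C ∧ M.eRk (C ∪ B') = 5 ∧ (M.closure (C ∪ B')).ncard = f)).bipartiteBelow (fun (B' : Set α) (xy : α × α) => xy.1 ∈ B' ∧ xy.2 ∈ B') (x, y),
        ∃ z, z ≠ x ∧ z ≠ y ∧ B' = {x, y} ∪ {z} ∧ C ∪ B' = insert z Q := by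
      intro B' hB'
      rw [Finset.mem_bipartiteBelow] at hB'
      obtain ⟨hB'mem, hxB', hyB'⟩ := hB'
      obtain ⟨⟨-, hB'3⟩, -, -, -⟩ := mem_extMax.1 hB'mem
      obtain ⟨z, hzx, hzy, hB'⟩ := exists_eq_of_ncard_eq_three hB'3 hxB' hyB' hxy
      refine ⟨z, hzx, hzy, hB', ?_⟩
      rw [hB', hQdef]
      ext w; simp only [Set.mem_union, Set.mem_insert_iff, Set.mem_singleton_iff]; tauto
    by_cases hQr : M.eRk Q = 4
    · set P : Set α := M.closure Q with hPdef
      have hPE : P ⊆ M.E := M.closure_subset_ground _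
      have hPflat : M.closure P = P := M.closure_closure _
      have hPr : M.eRk P = 4 := by rw [hPdef, M.eRk_closure_eq, hQr]
      have hP5 : 5 ≤ P.ncard := by
        have h1 : Q.ncard = 5 := by
          rw [hQdef, Set.ncard_insert_of_notMem (by
            intro h; rcases h with h | h
            · exact hxy h.symm
            · exact hyC h) (M.ground_finite.subset (Set.insert_subset hxE hCE)),
            Set.ncard_insert_of_notMem hxC (M.ground_finite.subset hCE), hC3]
        have h2 : Q.ncard ≤ P.ncard := Set.ncard_le_ncard (M.subset_closure _ hQE) (M.ground_finite.subset hPE)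
        omega
      have hfin : ({x ∈ M.E \ P | (M.closure (insert x P)).ncard = f}).Finite := M.ground_finite.subset (maxExt_subset_ground _ f)
      refine le_trans ?_ (he P hPE hPflat hPr hP5)
      rw [Set.ncard_eq_toFinset_card _ hfin]
      refine (Finset.card_le_card (?_ : _ ⊆ hfin.toFinset.image (fun z => ({x, y} : Set α) ∪ {z}))).trans
        Finset.card_image_le
      intro B' hB'
      obtain ⟨z, hzx, hzy, hB'eq, hunion⟩ := hfibre B' hB'
      rw [Finset.mem_bipartiteBelow] at hB'
      obtain ⟨⟨⟨hB'E, -⟩, -, hr, hcl⟩, -⟩ := And.imp_left mem_extMax.1 hB'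
      rw [Finset.mem_image]
      refine ⟨z, ?_, hB'eq.symm⟩
      rw [Set.Finite.mem_toFinset, mem_maxExt]
      have hzE : z ∈ M.E := hB'E (by rw [hB'eq]; exact Or.inr rfl)
      have hzP : z ∉ P := by
        intro hzP
        rw [hunion, eRk_insert_eq_of_mem_closure hzP, hQr] at hr
        norm_num at hr
      refine ⟨hzE, hzP, ?_⟩
      rw [hPdef, M.closure_insert_closure_eq_closure_insert, ← hunion]
      exact hcl
    · -- `ρ(Q) ≠ 4`: the fibre is empty (a spanning `6`-set through `Q` forces `ρ(Q) = 4`)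
      have : ((Matroid.subsF (Matroid.groundF M) 3).filter (fun B' => Disjoint B' C ∧ M.eRk (C ∪ B') = 5 ∧ (M.closure (C ∪ B')).ncard = f)).bipartiteBelow (fun (B' : Set α) (xy : α × α) => xy.1 ∈ B' ∧ xy.2 ∈ B') (x, y) = ∅ := by
        rw [Finset.eq_empty_iff_forall_notMem]
        intro B' hB'
        obtain ⟨z, -, -, -, hunion⟩ := hfibre B' hB'
        rw [Finset.mem_bipartiteBelow] at hB'
        obtain ⟨⟨-, -, hr, -⟩, -⟩ := And.imp_left mem_extMax.1 hB'
        rw [hunion] at hr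
        have h1 : M.eRk (insert z Q) ≤ M.eRk Q + 1 := M.eRk_insert_le_add_one _ _
        have h2 : M.eRk Q ≤ M.eRk C + 1 + 1 := by
          rw [hQdef]
          exact (M.eRk_insert_le_add_one _ _).trans (add_le_add (M.eRk_insert_le_add_one _ _) le_rfl)
        rw [hCr] at h2
        rw [hr] at h1
        obtain ⟨q, hq⟩ := ENat.ne_top_iff_exists.1 (eRk_ne_top_of_finite hQE)
        rw [← hq] at h1 h2 hQr
        norm_cast at h1 h2 hQr
        omega
      rw [this, Finset.card_empty]
      exact Nat.zero_le e

end S2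

end PercRepro
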